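import Literature.Analysis.FluidPDE.Tao2016AveragedNS.ReachCertificateSharp
import Literature.Analysis.FluidPDE.Tao2016AveragedNS.NegativeKickSharp
import HarnessLib

/-!
# The defect weight of Tao's gate: an adversarial forcing costs `1.27/√M` of its size, not `2`

HONEST FRAMING (cell `pub-fluidc`): low prior, high value-of-information experiment on Tao's
machine paradigm; NOT a claim that NS blows up.

The sharp shadowing chain (SeedScaleSharpIgnition → SeedScaleSharpEntry → SeedScaleSharpClosure,
packaged in CriticalBudget.lean / ReachCertificateSharp.lean) decides Theorem 5.3 of
[Tao2016AveragedNS, §5.5] along approximate trajectories by the TOTAL BUDGET `δ₀ + δT` — datum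
error `δ₀` plus sup-forcing `δ` times cycle time `T = 2` — with threshold
`√(π/2)·u·(1 ± 3·10⁻⁴)`, `u = ε²e^{-M}/√M`. The weight `T = 2` on the forcing is the generic
pseudo-orbit bookkeeping; for THIS gate it is lossy by a factor `≍ √M`: the trigger equation
`c' = ε⁻¹Mbc + ε²e^{-M}a² + f_c` weights a forcing `f_c` by the propagator `e^{-G}`,
`G(t) = ∫₀ᵗ ε⁻¹Mb ≥ 0.495·Mt² - 1/320` (the clock MINORANT of SeedScaleIgnition, `clockInt_ge_unit'`),
so what a sup-forcing of size `δ` can remove from the discounted trigger is at most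
`δ·∫₀^∞ e^{-G} ≤ δ·(e^{1/320}·√(π/(1.98M)) + late terms) ≤ 1.27·δ/√M` — the same Gaussian
ignition window of width `≍ 1/√M` that produces the `√(π/2)/√M` of the critical budget.

Results (standing hypotheses of the retuned family: `K ≥ 2·20⁴²·42! + 16`,
`3000 log K ≤ M ≤ K¹⁰`, `0 < ε ≤ e^{-10M}/K¹⁰⁰`; `s = ε²e^{-M}`, `u = s/√M`):
* §2 `IgnitionSharp.disc_one_geW`: `D(1) ≥ -δ₀ - 1.265·δ/√M + 1.253274·u` (SeedScaleSharpIgnition's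
  `disc_one_ge` had `-(51/50)δ`); `disc_persistW`: after time `1` the forcing costs
  `≤ δ·e^{-(0.495M - 1/320)}` per unit time; `residue_of_smallH_W`, `ignites_W`,
  `exists_triggerLevel_hit_W`: the ignition / trigger-level-hitting statements of the sharp chain
  under the WEIGHTED BUDGET PAIR
    `δ₀ + 2δ ≤ ε²e^{-M}/8`   (the weak a-priori budget of SeedScaleIgnition §3–§4) and
    `δ₀ + 1.27·δ/√M ≤ 1.2532·u` (the sharp, propagator-weighted budget).
* §3 `approxTrajectory_firedOn_late_W`, `approxTrajectory_firedOn_from_two_W`,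
  `IsPseudoOrbit.firedOn_from_two_W`: Theorem 5.3's conclusion (`|ã-1| ≤ 6K⁻²⁰`,
  `|a|,|b|,|c|,|d| ≤ 4K⁻¹⁰` on `[2,T]`) along every approximate trajectory / pseudo-orbit under the
  budget pair (plus `δT ≤ ε²/2` for the trivial continuation on `[2,T]`).
* §4 IN THE REACH INTERFACE (bp3's `ReachCertificate`): `taoReachW` — a reach certificate from
  `closedBall delayInit ρ` at defect level `εd` whenever `ρ + 1.27·εd/√M < 1.2532·u` and
  `ρ + 2εd < ε²e^{-M}/8`; so on the DEFECT AXIS the certified range grows from `εd < 0.6266·u`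
  (ReachCertificateSharp §4) to `εd < ε²e^{-M}/16 = u√M/16` — against the impossibility from
  `εd ≥ ε²e^{-M}` (ReachCertificateSharp §5b): the defect axis is now decided up to the factor `16`
  (was `≥ 1.59√M ≥ 122`), and the PRE-LOAD threshold is flat in the defect:
  `reachRadius K M ε εd ∈ [1.2532·u - 1.27·εd/√M, 1.2535·u]` for `εd ≤ ε²e^{-M}/16 - u`
  (`reachRadius_mem_Icc_W`); `taoReach_phases_W` is the updated budget plane.

What is NOT claimed: the factor `16` is the weak a-priori budget of SeedScaleIgnition (its §3–§4
bootstrap is run under `δ₀ + 2δ ≤ ε²e^{-M}/8`), not a feature of the gate — relaxing it to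
`δ < (1-η)ε²e^{-M}` (which the seed adversary shows is the true ceiling) would need that bootstrap
re-run and is not attempted; nothing for cycle times other than `2` on the sufficiency side; nothing
about Navier–Stokes.
-/

namespace Literature.Analysis.FluidPDE.Tao2016AveragedNS

open Real Set MeasureTheory Metric
open scoped NNReal
open NegKick (clockInt clockInt_zero)
open Literature.Analysis.FluidPDE.FluidComputer (ReachCertificate)

noncomputable section

/-! ## §1. Numerical lemmas: the propagator weights -/

namespace DefectWeight

/-- `e^{1/320} ≤ 1.0032`. [folklore] -/
theorem exp_inv_le : exp (1 / 320 : ℝ) ≤ 10032 / 10000 := by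
  have h := add_one_le_exp (-(1 / 320 : ℝ))
  have h' : exp (1 / 320 : ℝ) * exp (-(1 / 320 : ℝ)) = 1 := by rw [← exp_add]; simp
  nlinarith [exp_pos (1 / 320 : ℝ), exp_pos (-(1 / 320 : ℝ))]

/-- The early propagator weight: `∫₀¹ e^{-0.495·M r²} dr ≤ √(π/(0.495M))/2 ≤ 1.26/√M`
(`π < 3.1416`). [folklore] -/
theorem window_le {M : ℝ} (hM : 0 < M) :
    ∫ r in (0 : ℝ)..1, exp (-(99 / 200 * M) * r ^ 2) ≤ 126 / 100 / Real.sqrt M := by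
  refine (NegKick.integral_exp_neg_mul_sq_le (by positivity)).trans
    (NegKick.sqrt_pi_div_le_of hM (by norm_num) ?_)
  have hpi : π < 3.1416 := Real.pi_lt_d4
  nlinarith

/-- The late propagator weight: `(3/5)·e^{-(0.495M - 1/320)} ≤ 0.005/√M` for `M ≥ 6000`
(`e^{y} ≥ (1 + y/2)² ≥ 120M ≥ 120√M`). [folklore] -/
theorem late_le {M : ℝ} (hM : 6000 ≤ M) (hsM : Real.sqrt M ≤ M) :
    3 / 5 * exp (-(99 / 200 * M - 1 / 320)) ≤ 5 / 1000 / Real.sqrt M := by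
  have hsq0 : 0 < Real.sqrt M := Real.sqrt_pos.2 (by linarith)
  obtain ⟨y, hy⟩ : ∃ y : ℝ, y = 99 / 200 * M - 1 / 320 := ⟨_, rfl⟩
  have hy1 : 2969 ≤ y := by rw [hy]; linarith
  have hE : (1 + y / 2) ^ 2 ≤ exp y := by
    have h1 : exp y = exp (y / 2) ^ 2 := by rw [← exp_nat_mul]; ring_nf
    rw [h1]
    exact pow_le_pow_left₀ (by linarith) (by linarith [add_one_le_exp (y / 2)]) 2
  have hbig : 120 * Real.sqrt M ≤ exp y := by
    have h2 : 120 * M ≤ (1 + y / 2) ^ 2 := by rw [hy]; nlinarith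
    nlinarith
  have hinv : exp (-y) * exp y = 1 := by rw [← exp_add]; simp
  rw [← hy, le_div_iff₀ hsq0]
  nlinarith [exp_pos (-y), exp_pos y]

end DefectWeight

/-! ## §2. The weighted ignition analysis along approximate trajectories -/

namespace IgnitionSharp

open Ignition

section Approx

variable {K M ε δ δ₀ T : ℝ} {Y V : ℝ → Fin 5 → ℝ}
  (hY : ∀ t, HasDerivAt Y (V t) t)
  (hV : ∀ t ∈ Ico 0 T, ‖V t - delayCircuitWith K M ε (Y t)‖ ≤ δ)
  (hR : ∀ t ∈ Ico 0 T, ‖Y t‖ ≤ 2) (hT : 2 ≤ T)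
include hY hV hR hT

section Weak

variable (hK : 2 * 20 ^ 42 * (Nat.factorial 42 : ℝ) + 16 ≤ K) (hML : 3000 * Real.log K ≤ M)
  (hMK : M ≤ K ^ 10) (hε : 0 < ε) (hεle : ε ≤ exp (-(10 * M)) / K ^ 100)
  (h0 : ‖Y 0 - delayInit‖ ≤ δ₀) (hη : δ₀ + 2 * δ ≤ ε ^ 2 * exp (-M) / 8)
include hK hML hMK hε hεle h0 hη

/-- **The trigger equation on `[0,1]`, doubly Gaussian form**: with `s = ε²e^{-M}`, `λ⁺`, `τ₀` as in
SeedScaleSharpIgnition's `gauss_consts`,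
`D' ≥ s(1 - 2·10⁻⁵)e^{-τ₀}e^{-λ⁺u²} - 1.0032·δ·e^{-0.495Mu²}`: the forcing is discounted by the clock
MINORANT `G ≥ 0.495Mu² - 1/320` (`clockInt_ge_unit'`), not merely by `G ≥ -1/100`.
[cite: Tao2016AveragedNS, §5.5 proof of Theorem 5.3] -/
theorem disc_deriv_ge_gaussW {u : ℝ} (hu : u ∈ Icc (0 : ℝ) 1) :
    ε ^ 2 * exp (-M) * (1 - 1 / 50000) * exp (-(ε⁻¹ * M * δ₀)) *
          exp (-(ε⁻¹ * M * (ε * (1 + 7 * δ₀ + 32 * δ) + δ) / 2) * u ^ 2) -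
        10032 / 10000 * δ * exp (-(99 / 200 * M) * u ^ 2) ≤
      (V u 2 - ε⁻¹ * M * Y u 1 * Y u 2) * exp (-clockInt ε M Y u) := by
  obtain ⟨hM6000, -, -, -, -, -, -, -, -⟩ := ignition_params hK hML hMK hε hεle
  obtain ⟨hδ₀, hδ, -, -, -, -⟩ := budget_facts' hV hT hK hML hMK hε hεle h0 hη
  have hu' : u ∈ Icc (0 : ℝ) (8 / 5) := ⟨hu.1, by linarith [hu.2]⟩
  have h1 := disc_deriv_geA hV hT hu' (K := K)
  have ha := a_sq_ge_unit_fine hY hV hR hT hK hML hMK hε hεle h0 hη hu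
  have hGle := clockInt_le_gauss hY hV hR hT hK hML hMK hε hεle h0 hη hu
  have hGge := clockInt_ge_unit' hY hV hR hT hK hML hMK hε hεle h0 hη hu
  have he := DefectWeight.exp_inv_le
  obtain ⟨l, hl⟩ : ∃ l : ℝ, l = ε⁻¹ * M * (ε * (1 + 7 * δ₀ + 32 * δ) + δ) / 2 := ⟨_, rfl⟩
  obtain ⟨τ₀, hτ₀⟩ : ∃ τ₀ : ℝ, τ₀ = ε⁻¹ * M * δ₀ := ⟨_, rfl⟩
  obtain ⟨s, hs⟩ : ∃ s : ℝ, s = ε ^ 2 * exp (-M) := ⟨_, rfl⟩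
  rw [← hl, ← hτ₀] at hGle ⊢
  rw [← hs] at h1 ⊢
  have hs0 : 0 < s := by rw [hs]; positivity
  have h2 : exp (-τ₀) * exp (-l * u ^ 2) ≤ exp (-clockInt ε M Y u) := by
    rw [← exp_add]; exact exp_le_exp.2 (by linarith)
  have h3 : s * (1 - 1 / 50000) * exp (-τ₀) * exp (-l * u ^ 2) ≤
      s * Y u 0 ^ 2 * exp (-clockInt ε M Y u) :=
    calc s * (1 - 1 / 50000) * exp (-τ₀) * exp (-l * u ^ 2)
        = s * (1 - 1 / 50000) * (exp (-τ₀) * exp (-l * u ^ 2)) := by ring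
      _ ≤ s * Y u 0 ^ 2 * exp (-clockInt ε M Y u) :=
          mul_le_mul (mul_le_mul_of_nonneg_left ha hs0.le) h2 (by positivity) (by positivity)
  have h4 : δ * exp (-clockInt ε M Y u) ≤ 10032 / 10000 * δ * exp (-(99 / 200 * M) * u ^ 2) := by
    have h5 : exp (-clockInt ε M Y u) ≤ exp (1 / 320) * exp (-(99 / 200 * M) * u ^ 2) := by
      rw [← exp_add]; exact exp_le_exp.2 (by linarith)
    have h6 : exp (1 / 320) * exp (-(99 / 200 * M) * u ^ 2) ≤
        10032 / 10000 * exp (-(99 / 200 * M) * u ^ 2) :=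
      mul_le_mul_of_nonneg_right he (exp_pos _).le
    have h7 := mul_le_mul_of_nonneg_left (h5.trans h6) hδ
    linarith
  have h5 : (s * Y u 0 ^ 2 - δ) * exp (-clockInt ε M Y u) =
      s * Y u 0 ^ 2 * exp (-clockInt ε M Y u) - δ * exp (-clockInt ε M Y u) := by ring
  linarith

/-- **The weighted Gaussian-window deposit, integral form**:
`D(1) ≥ -δ₀ - 1.0032·δ·∫₀¹e^{-0.495Mr²}dr + s(1 - 2·10⁻⁵)e^{-τ₀}∫₀¹e^{-λ⁺r²}dr`.
[cite: Tao2016AveragedNS, §5.5 proof of Theorem 5.3] -/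
theorem disc_one_ge_integralW :
    -δ₀ - 10032 / 10000 * δ * (∫ r in (0 : ℝ)..1, exp (-(99 / 200 * M) * r ^ 2)) +
        ε ^ 2 * exp (-M) * (1 - 1 / 50000) * exp (-(ε⁻¹ * M * δ₀)) *
          ∫ r in (0 : ℝ)..1, exp (-(ε⁻¹ * M * (ε * (1 + 7 * δ₀ + 32 * δ) + δ) / 2) * r ^ 2) ≤
      Y 1 2 * exp (-clockInt ε M Y 1) := by
  obtain ⟨l, hl⟩ : ∃ l : ℝ, l = ε⁻¹ * M * (ε * (1 + 7 * δ₀ + 32 * δ) + δ) / 2 := ⟨_, rfl⟩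
  obtain ⟨A, hA⟩ : ∃ A : ℝ, A = ε ^ 2 * exp (-M) * (1 - 1 / 50000) * exp (-(ε⁻¹ * M * δ₀)) :=
    ⟨_, rfl⟩
  obtain ⟨k, hk⟩ : ∃ k : ℝ, k = 10032 / 10000 * δ := ⟨_, rfl⟩
  rw [← hl, ← hA, ← hk]
  have hcont : Continuous fun r : ℝ => exp (-l * r ^ 2) := by fun_prop
  have hcont2 : Continuous fun r : ℝ => exp (-(99 / 200 * M) * r ^ 2) := by fun_prop
  have hmono := Thm53.monotoneOn_sub_of_le_deriv (s := Icc (0 : ℝ) 1)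
    (f := fun u => Y u 2 * exp (-clockInt ε M Y u))
    (φ := fun u => A * exp (-l * u ^ 2) - k * exp (-(99 / 200 * M) * u ^ 2))
    (Φ := fun u => A * (∫ r in (0 : ℝ)..u, exp (-l * r ^ 2)) -
      k * (∫ r in (0 : ℝ)..u, exp (-(99 / 200 * M) * r ^ 2)))
    (convex_Icc 0 1) (fun u _ => hasDerivAt_discA hY u)
    (fun u _ => ((((hcont.integral_hasStrictDerivAt 0 u).hasDerivAt).const_mul A).sub
      (((hcont2.integral_hasStrictDerivAt 0 u).hasDerivAt).const_mul k)).congr_deriv (by ring))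
    (fun u hu => by
      show A * exp (-l * u ^ 2) - k * exp (-(99 / 200 * M) * u ^ 2) ≤ _
      have h := disc_deriv_ge_gaussW hY hV hR hT hK hML hMK hε hεle h0 hη hu
      rw [← hl, ← hA, ← hk] at h
      exact h)
  have h := hmono (left_mem_Icc.2 zero_le_one) (right_mem_Icc.2 zero_le_one) zero_le_one
  simp only [clockInt_zero, neg_zero, exp_zero, mul_one, intervalIntegral.integral_same,
    mul_zero, sub_zero] at h
  have hc0 := (abs_le.1 (abs_init_coord_le h0).2.1).1
  linarith

/-- **The weighted Gaussian-window deposit.** `D(1) ≥ -δ₀ - 1.265·δ/√M + 1.253274·ε²e^{-M}/√M`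
(`∫₀¹e^{-λ⁺r²} ≥ 1.2533/√M` as in `disc_one_ge`; `1.0032·∫₀¹e^{-0.495Mr²} ≤ 1.0032·1.26/√M`).
[cite: Tao2016AveragedNS, §5.5 proof of Theorem 5.3] -/
theorem disc_one_geW :
    -δ₀ - 1265 / 1000 * δ / Real.sqrt M + 1253274 / 1000000 * (ε ^ 2 * exp (-M)) / Real.sqrt M ≤
      Y 1 2 * exp (-clockInt ε M Y 1) := by
  obtain ⟨hM6000, -, -, -, -, -, -, h77, -⟩ := ignition_params hK hML hMK hε hεle
  obtain ⟨hδ₀, hδ, -, -, -, -⟩ := budget_facts' hV hT hK hML hMK hε hεle h0 hη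
  obtain ⟨hl1, hl2, hτ⟩ := gauss_consts hV hT hK hML hMK hε hεle h0 hη
  have hraw := disc_one_ge_integralW hY hV hR hT hK hML hMK hε hεle h0 hη
  obtain ⟨l, hl⟩ : ∃ l : ℝ, l = ε⁻¹ * M * (ε * (1 + 7 * δ₀ + 32 * δ) + δ) / 2 := ⟨_, rfl⟩
  obtain ⟨τ₀, hτ₀⟩ : ∃ τ₀ : ℝ, τ₀ = ε⁻¹ * M * δ₀ := ⟨_, rfl⟩
  obtain ⟨s, hs⟩ : ∃ s : ℝ, s = ε ^ 2 * exp (-M) := ⟨_, rfl⟩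
  rw [← hl] at hl1 hl2 hraw
  rw [← hτ₀] at hτ hraw
  rw [← hs] at hraw ⊢
  have hs0 : 0 < s := by rw [hs]; positivity
  have hM0 : 0 < M := by linarith
  have hsq0 : 0 < Real.sqrt M := by linarith
  have hW := window_mass_ge_of hM6000 hl1 hl2
  have heτ : 1 - 1 / 10000000 ≤ exp (-τ₀) := by
    have h := add_one_le_exp (-τ₀)
    linarith
  have hAW : 1253274 / 1000000 * s / Real.sqrt M ≤
      s * (1 - 1 / 50000) * exp (-τ₀) * ∫ r in (0 : ℝ)..1, exp (-l * r ^ 2) := by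
    have h1 : s * (1 - 1 / 50000) * (1 - 1 / 10000000) ≤ s * (1 - 1 / 50000) * exp (-τ₀) :=
      mul_le_mul_of_nonneg_left heτ (by positivity)
    have h2 : s * (1 - 1 / 50000) * (1 - 1 / 10000000) * (12533 / 10000 / Real.sqrt M) ≤
        s * (1 - 1 / 50000) * exp (-τ₀) * ∫ r in (0 : ℝ)..1, exp (-l * r ^ 2) :=
      mul_le_mul h1 hW (by positivity) (by positivity)
    have h3 : 1253274 / 1000000 * s / Real.sqrt M ≤
        s * (1 - 1 / 50000) * (1 - 1 / 10000000) * (12533 / 10000 / Real.sqrt M) := by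
      rw [show s * (1 - 1 / 50000) * (1 - 1 / 10000000) * (12533 / 10000 / Real.sqrt M) =
        (1 - 1 / 50000) * (1 - 1 / 10000000) * (12533 / 10000) * s / Real.sqrt M by ring]
      have hnum : (1253274 / 1000000 : ℝ) ≤
          (1 - 1 / 50000) * (1 - 1 / 10000000) * (12533 / 10000) := by norm_num
      exact div_le_div_of_nonneg_right (mul_le_mul_of_nonneg_right hnum hs0.le) hsq0.le
    exact h3.trans h2
  -- the forcing weight
  have hU := DefectWeight.window_le hM0
  have hkU : 10032 / 10000 * δ * (∫ r in (0 : ℝ)..1, exp (-(99 / 200 * M) * r ^ 2)) ≤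
      10032 / 10000 * δ * (126 / 100 / Real.sqrt M) :=
    mul_le_mul_of_nonneg_left hU (by positivity)
  have hkU' : 10032 / 10000 * δ * (126 / 100 / Real.sqrt M) ≤ 1265 / 1000 * δ / Real.sqrt M := by
    rw [show 10032 / 10000 * δ * (126 / 100 / Real.sqrt M) =
      10032 / 10000 * (126 / 100) * δ / Real.sqrt M by ring]
    exact div_le_div_of_nonneg_right (mul_le_mul_of_nonneg_right (by norm_num) hδ) hsq0.le
  linarith

omit hR in
/-- **Weighted persistence of the discounted trigger after time `1`**: if `G ≥ 0.495M - 1/320` on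
`[1, τ]` (`τ ≤ 8/5`), then `D(t) ≥ D(1) - δe^{-(0.495M - 1/320)}(t - 1)` for `t ∈ [1, τ]`
(`D' ≥ -δe^{-G}`). [cite: Tao2016AveragedNS, §5.5] -/
theorem disc_persistW {τ : ℝ} (hτ : τ ≤ 8 / 5)
    (hG : ∀ u ∈ Icc (1 : ℝ) τ, 99 / 200 * M - 1 / 320 ≤ clockInt ε M Y u) {t : ℝ}
    (ht : t ∈ Icc (1 : ℝ) τ) :
    Y 1 2 * exp (-clockInt ε M Y 1) - δ * exp (-(99 / 200 * M - 1 / 320)) * (t - 1) ≤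
      Y t 2 * exp (-clockInt ε M Y t) := by
  obtain ⟨hδ₀, hδ, -, -, -, -⟩ := budget_facts' hV hT hK hML hMK hε hεle h0 hη
  obtain ⟨k, hk⟩ : ∃ k : ℝ, k = δ * exp (-(99 / 200 * M - 1 / 320)) := ⟨_, rfl⟩
  rw [← hk]
  have hmono := Thm53.monotoneOn_sub_of_le_deriv (s := Icc (1 : ℝ) τ)
    (f := fun s => Y s 2 * exp (-clockInt ε M Y s)) (φ := fun _ => -k)
    (Φ := fun u => -k * u) (convex_Icc 1 τ) (fun u _ => hasDerivAt_discA hY u)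
    (fun u _ => by simpa using (hasDerivAt_id u).const_mul (-k))
    (fun u hu => by
      have hu' : u ∈ Icc (0 : ℝ) (8 / 5) := ⟨by linarith [hu.1], hu.2.trans hτ⟩
      have h1 := disc_deriv_geA hV hT hu' (K := K)
      have h2 : exp (-clockInt ε M Y u) ≤ exp (-(99 / 200 * M - 1 / 320)) :=
        exp_le_exp.2 (by linarith [hG u hu])
      have h3 : 0 ≤ ε ^ 2 * exp (-M) * Y u 0 ^ 2 * exp (-clockInt ε M Y u) := by positivity
      have h4 : δ * exp (-clockInt ε M Y u) ≤ k := by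
        rw [hk]; exact mul_le_mul_of_nonneg_left h2 hδ
      have h5 : (ε ^ 2 * exp (-M) * Y u 0 ^ 2 - δ) * exp (-clockInt ε M Y u) =
          ε ^ 2 * exp (-M) * Y u 0 ^ 2 * exp (-clockInt ε M Y u) -
            δ * exp (-clockInt ε M Y u) := by ring
      show -k ≤ _
      linarith)
  have h := hmono ⟨le_rfl, ht.1.trans ht.2⟩ ht ht.1
  simp only at h
  linarith

/-- After time `1` the clock integral does not decrease while `|c| ≤ ε²` (`b ≥ (49/50)ε > 0` there,
`b_ge_late_of_smallH'`), so `G ≥ G(1) ≥ 0.495M - 1/320` on `[1, τ]`.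
[cite: Tao2016AveragedNS, §5.5] -/
theorem clockInt_ge_late_of_smallH {τ : ℝ} (hτ : τ ≤ 8 / 5)
    (hc : ∀ t ∈ Icc (0 : ℝ) τ, |Y t 2| ≤ ε ^ 2) {u : ℝ} (hu : u ∈ Icc (1 : ℝ) τ) :
    99 / 200 * M - 1 / 320 ≤ clockInt ε M Y u := by
  obtain ⟨hM6000, -, -, -, -, -, -, -, -⟩ := ignition_params hK hML hMK hε hεle
  have hM : 0 ≤ M := by linarith
  have hG1 := clockInt_ge_unit' hY hV hR hT hK hML hMK hε hεle h0 hη (u := 1)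
    ⟨zero_le_one, le_rfl⟩
  have hmono := Thm53.monotoneOn_sub_of_le_deriv (s := Icc (1 : ℝ) τ) (f := clockInt ε M Y)
    (φ := fun _ => (0 : ℝ)) (Φ := fun _ => (0 : ℝ)) (convex_Icc 1 τ)
    (fun t _ => hasDerivAt_clockIntA hY t) (fun t _ => hasDerivAt_const t (0 : ℝ))
    (fun t ht => by
      have hb := b_ge_late_of_smallH' hY hV hR hT hK hML hMK hε hεle h0 hη hτ hc ht
      have hb0 : 0 ≤ Y t 1 := by nlinarith
      show (0 : ℝ) ≤ ε⁻¹ * M * Y t 1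
      exact mul_nonneg (mul_nonneg (inv_nonneg.2 hε.le) hM) hb0)
  have h := hmono ⟨le_rfl, hu.1.trans hu.2⟩ hu hu.1
  simp only [sub_zero] at h
  norm_num at hG1
  linarith

end Weak

/-! ### The weighted budget pair -/

section Weighted

variable (hK : 2 * 20 ^ 42 * (Nat.factorial 42 : ℝ) + 16 ≤ K) (hML : 3000 * Real.log K ≤ M)
  (hMK : M ≤ K ^ 10) (hε : 0 < ε) (hεle : ε ≤ exp (-(10 * M)) / K ^ 100)
  (h0 : ‖Y 0 - delayInit‖ ≤ δ₀)
include hK hML hMK hε hεle h0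

/-- If `|c| ≤ ε²` on `[0, τ]` (`τ ≤ 8/5`), the discounted trigger keeps the residue
`D(t) ≥ ε²e^{-M}/(16000√M)` — hence `c(t) > 0` — for `t ∈ [1, τ]` under the WEIGHTED budget pair
(`D(1) ≥ -δ₀ - 1.265δ/√M + 1.253274u`, late loss `≤ 0.005δ/√M`, and `δ₀ + 1.27δ/√M ≤ 1.2532u`).
Compare `residue_of_smallH_sharp` (budget `δ₀ + 2δ ≤ 1.2532u`). [cite: Tao2016AveragedNS, §5.5] -/
theorem residue_of_smallH_W (hη : δ₀ + 2 * δ ≤ ε ^ 2 * exp (-M) / 8)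
    (hW : δ₀ + 127 / 100 * δ / Real.sqrt M ≤ 3133 / 2500 * (ε ^ 2 * exp (-M)) / Real.sqrt M)
    {τ : ℝ} (hτ : τ ≤ 8 / 5)
    (hc : ∀ t ∈ Icc (0 : ℝ) τ, |Y t 2| ≤ ε ^ 2) {t : ℝ} (ht : t ∈ Icc (1 : ℝ) τ) :
    ε ^ 2 * exp (-M) / (16000 * Real.sqrt M) ≤ Y t 2 * exp (-clockInt ε M Y t) ∧ 0 < Y t 2 := by
  obtain ⟨hM6000, hε1, hε2, hexpM, hMe, hMe2, hMse, h77, hsM⟩ := ignition_params hK hML hMK hε hεle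
  obtain ⟨hδ₀, hδ, -, -, -, -⟩ := budget_facts' hV hT hK hML hMK hε hεle h0 hη
  have hsq0 : 0 < Real.sqrt M := by linarith
  have hwin := disc_one_geW hY hV hR hT hK hML hMK hε hεle h0 hη
  have hGl : ∀ u ∈ Icc (1 : ℝ) τ, 99 / 200 * M - 1 / 320 ≤ clockInt ε M Y u := fun u hu =>
    clockInt_ge_late_of_smallH hY hV hR hT hK hML hMK hε hεle h0 hη hτ hc hu
  have hp := disc_persistW hY hV hT hK hML hMK hε hεle h0 hη hτ hGl ht
  have hlate := DefectWeight.late_le hM6000 hsM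
  have ht1 : t - 1 ≤ 3 / 5 := by linarith [ht.2]
  have h1 : δ * exp (-(99 / 200 * M - 1 / 320)) * (t - 1) ≤
      δ * exp (-(99 / 200 * M - 1 / 320)) * (3 / 5) :=
    mul_le_mul_of_nonneg_left ht1 (mul_nonneg hδ (exp_pos _).le)
  have h2 : δ * exp (-(99 / 200 * M - 1 / 320)) * (3 / 5) ≤ δ * (5 / 1000 / Real.sqrt M) := by
    rw [show δ * exp (-(99 / 200 * M - 1 / 320)) * (3 / 5) =
      δ * (3 / 5 * exp (-(99 / 200 * M - 1 / 320))) by ring]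
    exact mul_le_mul_of_nonneg_left hlate hδ
  have h3 : δ * (5 / 1000 / Real.sqrt M) = 5 / 1000 * δ / Real.sqrt M := by ring
  have h4 : 1265 / 1000 * δ / Real.sqrt M + 5 / 1000 * δ / Real.sqrt M =
      127 / 100 * δ / Real.sqrt M := by ring
  have h5 : ε ^ 2 * exp (-M) / (16000 * Real.sqrt M) =
      1253274 / 1000000 * (ε ^ 2 * exp (-M)) / Real.sqrt M -
        12532115 / 10000000 * (ε ^ 2 * exp (-M)) / Real.sqrt M := by
    field_simp; ring
  have h6 : 3133 / 2500 * (ε ^ 2 * exp (-M)) / Real.sqrt M ≤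
      12532115 / 10000000 * (ε ^ 2 * exp (-M)) / Real.sqrt M :=
    div_le_div_of_nonneg_right (by nlinarith [mul_pos (pow_pos hε 2) (exp_pos (-M))]) hsq0.le
  have hD : ε ^ 2 * exp (-M) / (16000 * Real.sqrt M) ≤ Y t 2 * exp (-clockInt ε M Y t) := by
    rw [h5]; linarith
  refine ⟨hD, ?_⟩
  have hp0 : 0 < ε ^ 2 * exp (-M) / (16000 * Real.sqrt M) := by positivity
  by_contra hle
  have : Y t 2 * exp (-clockInt ε M Y t) ≤ 0 :=
    mul_nonpos_of_nonpos_of_nonneg (le_of_not_gt hle) (exp_pos _).le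
  linarith

/-- **Weighted ignition.** Under the weighted budget pair the trigger exceeds `ε²` in absolute value
somewhere on `[0, 8/5]` (else `c(8/5) = D(8/5)e^{G(8/5)} ≥ u/16000·(2M/75)³ > 3ε²`). Compare
`ignitesWithin_sharp` (budget `δ₀ + 2δ ≤ 1.2532u`). [cite: Tao2016AveragedNS, §5.5 Theorem 5.3] -/
theorem ignites_W (hη : δ₀ + 2 * δ ≤ ε ^ 2 * exp (-M) / 8)
    (hW : δ₀ + 127 / 100 * δ / Real.sqrt M ≤ 3133 / 2500 * (ε ^ 2 * exp (-M)) / Real.sqrt M) :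
    ∃ t ∈ Icc (0 : ℝ) (8 / 5), ε ^ 2 < |Y t 2| := by
  obtain ⟨hM6000, hε1, hε2, hexpM, hMe, hMe2, hMse, h77, hsM⟩ := ignition_params hK hML hMK hε hεle
  have hM0 : 0 < M := by linarith
  have hsq0 : 0 < Real.sqrt M := by linarith
  by_contra hcon
  simp only [not_exists, not_and, not_lt] at hcon
  have hc : ∀ t ∈ Icc (0 : ℝ) (8 / 5), |Y t 2| ≤ ε ^ 2 := fun t ht => hcon t ht
  have hD := (residue_of_smallH_W hY hV hR hT hK hML hMK hε hεle h0 hη hW (τ := 8 / 5) le_rfl hc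
    (t := 8 / 5) ⟨by norm_num, le_rfl⟩).1
  have hG := clockInt_late_of_small' hY hV hR hT hK hML hMK hε hεle h0 hη hc
  -- e^{G(8/5) - M} ≥ (2M/75)³
  obtain ⟨x, hx⟩ : ∃ x : ℝ, x = clockInt ε M Y (8 / 5) - M := ⟨_, rfl⟩
  have hx1 : 2 * M / 25 ≤ x := by rw [hx]; linarith
  have hx0 : 0 ≤ x := by linarith
  have hEG : (2 * M / 75) ^ 3 ≤ exp x := by
    have h1 : exp x = exp (x / 3) ^ 3 := by rw [← exp_nat_mul]; ring_nf
    rw [h1]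
    calc (2 * M / 75) ^ 3 ≤ (x / 3 + 1) ^ 3 := pow_le_pow_left₀ (by positivity) (by linarith) 3
      _ ≤ exp (x / 3) ^ 3 := pow_le_pow_left₀ (by positivity) (add_one_le_exp (x / 3)) 3
  -- c(8/5) = D(8/5)·e^{G(8/5)}
  have hc85 : ε ^ 2 * exp (-M) / (16000 * Real.sqrt M) * exp (clockInt ε M Y (8 / 5)) ≤
      Y (8 / 5) 2 := by
    have h1 : Y (8 / 5) 2 = (Y (8 / 5) 2 * exp (-clockInt ε M Y (8 / 5))) *
        exp (clockInt ε M Y (8 / 5)) := by rw [mul_assoc, ← exp_add]; simp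
    rw [h1]
    exact mul_le_mul_of_nonneg_right hD (exp_pos _).le
  have hkey : ε ^ 2 < ε ^ 2 * exp (-M) / (16000 * Real.sqrt M) * exp (clockInt ε M Y (8 / 5)) := by
    have h1 : ε ^ 2 * exp (-M) / (16000 * Real.sqrt M) * exp (clockInt ε M Y (8 / 5)) =
        ε ^ 2 / (16000 * Real.sqrt M) * exp x := by
      rw [hx, exp_sub, exp_neg]; field_simp
    rw [h1]
    have h2 : ε ^ 2 / (16000 * Real.sqrt M) * (2 * M / 75) ^ 3 ≤
        ε ^ 2 / (16000 * Real.sqrt M) * exp x :=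
      mul_le_mul_of_nonneg_left hEG (by positivity)
    have hMs : M / Real.sqrt M = Real.sqrt M := Real.div_sqrt
    have h3 : ε ^ 2 / (16000 * Real.sqrt M) * (2 * M / 75) ^ 3 =
        8 / (16000 * 421875) * ε ^ 2 * M ^ 2 * (M / Real.sqrt M) := by
      field_simp; ring
    rw [hMs] at h3
    have h4 : (36000000 : ℝ) ≤ M ^ 2 := by nlinarith
    have h5 : (36000000 : ℝ) * 77 ≤ M ^ 2 * Real.sqrt M := mul_le_mul h4 h77 (by norm_num) (by positivity)
    have h6 : ε ^ 2 < 8 / (16000 * 421875) * ε ^ 2 * M ^ 2 * Real.sqrt M := by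
      have h61 : (1 : ℝ) < 8 / (16000 * 421875) * (M ^ 2 * Real.sqrt M) := by nlinarith
      have h62 := mul_lt_mul_of_pos_left h61 (pow_pos hε 2)
      linarith [h62]
    linarith [h2, h3]
  have hlast := hc (8 / 5) ⟨by norm_num, le_rfl⟩
  have habs : Y (8 / 5) 2 ≤ |Y (8 / 5) 2| := le_abs_self _
  linarith

/-- **First hitting time of the trigger level, weighted budget pair.** As
`exists_triggerLevel_hit_sharp`, with the sharp budget `δ₀ + 2δ ≤ 1.2532u` replaced by the pair
`δ₀ + 2δ ≤ ε²e^{-M}/8`, `δ₀ + 1.27δ/√M ≤ 1.2532u`: there is `τ ∈ (1, 8/5]` with `c(τ) = ε²/K¹⁰`,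
`|c| < ε²/K¹⁰` on `[0, τ)`, residue `c·e^{-G} ≥ ε²e^{-M}/(16000√M)` and `b ≥ (49/50)ε` on `[1, τ]`,
and `|b| ≤ 2ε`, `a² ≥ 999/1000`, `|d|, |ã| ≤ 4/K¹⁰` on `[0, τ]`.
[cite: Tao2016AveragedNS, §5.5 Theorem 5.3] -/
theorem exists_triggerLevel_hit_W (hη : δ₀ + 2 * δ ≤ ε ^ 2 * exp (-M) / 8)
    (hW : δ₀ + 127 / 100 * δ / Real.sqrt M ≤ 3133 / 2500 * (ε ^ 2 * exp (-M)) / Real.sqrt M) :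
    ∃ τ ∈ Ioc (1 : ℝ) (8 / 5), Y τ 2 = ε ^ 2 / K ^ 10 ∧
      (∀ t ∈ Ico (0 : ℝ) τ, |Y t 2| < ε ^ 2 / K ^ 10) ∧
      (∀ t ∈ Icc (1 : ℝ) τ,
        ε ^ 2 * exp (-M) / (16000 * Real.sqrt M) ≤ Y t 2 * exp (-clockInt ε M Y t)) ∧
      (∀ t ∈ Icc (1 : ℝ) τ, 49 / 50 * ε ≤ Y t 1) ∧
      (∀ t ∈ Icc (0 : ℝ) τ, |Y t 1| ≤ 2 * ε ∧ 999 / 1000 ≤ Y t 0 ^ 2 ∧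
        |Y t 3| ≤ 4 / K ^ 10 ∧ |Y t 4| ≤ 4 / K ^ 10) := by
  obtain ⟨hM6000, hε1, hε2, hexpM, hMe, hMe2, hMse, h77, hsM⟩ := ignition_params hK hML hMK hε hεle
  obtain ⟨hδ₀, hδ, hη8, hδ₀1, h732, hs1⟩ := budget_facts' hV hT hK hML hMK hε hεle h0 hη
  obtain ⟨hℓ0, hℓε, hℓ3, hsK, hK10⟩ := level_facts hK hML hMK hε hεle
  obtain ⟨ℓ, hℓ⟩ : ∃ ℓ : ℝ, ℓ = ε ^ 2 / K ^ 10 := ⟨_, rfl⟩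
  rw [← hℓ] at hℓ0 hℓε hℓ3 ⊢
  -- a window time at which `|c| > ε²`: the weighted ignition theorem
  obtain ⟨t₀, ht₀, hgt⟩ := ignites_W hY hV hR hT hK hML hMK hε hεle h0 hη hW
  -- the closed set of window times at which `|c| ≥ ℓ`, and its infimum
  obtain ⟨S, hS⟩ : ∃ S : Set ℝ, S = Icc (0 : ℝ) (8 / 5) ∩ {t | ℓ ≤ |Y t 2|} := ⟨_, rfl⟩
  have hne : S.Nonempty := ⟨t₀, by rw [hS]; exact ⟨ht₀, hℓε.trans hgt.le⟩⟩
  have hbdd : BddBelow S := ⟨0, fun t ht => by rw [hS] at ht; exact ht.1.1⟩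
  have hcl : IsClosed S := by
    rw [hS]
    exact isClosed_Icc.inter (isClosed_le continuous_const (continuous_coord hY 2).abs)
  obtain ⟨τ, hτ⟩ : ∃ τ : ℝ, τ = sInf S := ⟨_, rfl⟩
  have hmem : τ ∈ S := by rw [hτ]; exact hcl.csInf_mem hne hbdd
  have hτS : τ ∈ Icc (0 : ℝ) (8 / 5) ∧ ℓ ≤ |Y τ 2| := by rw [hS] at hmem; exact hmem
  have hτ85 : τ ≤ 8 / 5 := hτS.1.2
  have hbefore : ∀ t ∈ Icc (0 : ℝ) (8 / 5), t < τ → |Y t 2| < ℓ := by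
    intro t ht htτ
    by_contra hge
    have htS : t ∈ S := by rw [hS]; exact ⟨ht, le_of_not_gt hge⟩
    have := csInf_le hbdd htS
    rw [← hτ] at this
    linarith
  -- `τ > 1`: on `[0,1]` the trigger is below `3ε²e^{-M/2} < ℓ`
  have hτ1 : 1 < τ := by
    by_contra hle
    have h := abs_c_le_unit' hY hV hR hT hK hML hMK hε hεle h0 hη ⟨hτS.1.1, le_of_not_gt hle⟩
    linarith [hτS.2]
  -- `|c(τ)| = ℓ` by the intermediate value theorem and minimality
  have hc0 : |Y 0 2| < ℓ := by
    have h := (abs_init_coord_le h0).2.1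
    have : ε ^ 2 * exp (-M) ≤ ε ^ 2 * exp (-(M / 2)) :=
      mul_le_mul_of_nonneg_left (exp_le_exp.2 (by linarith)) (sq_nonneg ε)
    linarith
  have habsτ : |Y τ 2| = ℓ := by
    have hcont : ContinuousOn (fun t => |Y t 2|) (Icc 0 τ) :=
      ((continuous_coord hY 2).abs).continuousOn
    obtain ⟨t, ht, hteq⟩ := intermediate_value_Icc hτS.1.1 hcont ⟨hc0.le, hτS.2⟩
    have htS : t ∈ S := by rw [hS]; exact ⟨⟨ht.1, ht.2.trans hτ85⟩, hteq.ge⟩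
    have hτt : τ ≤ t := by rw [hτ]; exact csInf_le hbdd htS
    have hte : t = τ := le_antisymm ht.2 hτt
    rw [← hte]; exact hteq
  have hcℓ : ∀ t ∈ Icc (0 : ℝ) τ, |Y t 2| ≤ ℓ := fun t ht => by
    rcases eq_or_lt_of_le ht.2 with h | h
    · rw [h, habsτ]
    · exact (hbefore t ⟨ht.1, ht.2.trans hτ85⟩ h).le
  have hcε : ∀ t ∈ Icc (0 : ℝ) τ, |Y t 2| ≤ ε ^ 2 := fun t ht => (hcℓ t ht).trans hℓε
  have hres : ∀ t ∈ Icc (1 : ℝ) τ,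
      ε ^ 2 * exp (-M) / (16000 * Real.sqrt M) ≤ Y t 2 * exp (-clockInt ε M Y t) :=
    fun t ht => (residue_of_smallH_W hY hV hR hT hK hML hMK hε hεle h0 hη hW hτ85 hcε ht).1
  have hpos : ∀ t ∈ Icc (1 : ℝ) τ, 0 < Y t 2 :=
    fun t ht => (residue_of_smallH_W hY hV hR hT hK hML hMK hε hεle h0 hη hW hτ85 hcε ht).2
  -- sign at `τ`
  have hposτ := hpos τ ⟨hτ1.le, le_rfl⟩
  have hceq : Y τ 2 = ℓ := by rw [← habsτ, abs_of_pos hposτ]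
  refine ⟨τ, ⟨hτ1, hτ85⟩, hceq, fun t ht => hbefore t ⟨ht.1, ht.2.le.trans hτ85⟩ ht.2, hres,
    fun t ht => b_ge_late_of_smallH' hY hV hR hT hK hML hMK hε hεle h0 hη hτ85 hcε ht,
    fun t ht => ?_⟩
  have hb := abs_b_le_of_smallH' hY hV hR hT hK hML hMK hε hεle h0 hη hτ85 hcε ht
  have hde := de_le_of_abs_c_le hY hV hR hT h0 hε hℓ0.le hτ85 hcℓ ht
  -- `2δ₀ + (2δ + 2ℓ/ε²)t ≤ 4/K¹⁰`
  have hℓK : 2 * ℓ / ε ^ 2 = 2 / K ^ 10 := by rw [hℓ]; field_simp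
  rw [hℓK] at hde
  have hsmall : 2 * δ₀ + (2 * δ + 2 / K ^ 10) * t ≤ 4 / K ^ 10 := by
    have ht85 : t ≤ 8 / 5 := ht.2.trans hτ85
    have h1 : (2 * δ + 2 / K ^ 10) * t ≤ (2 * δ + 2 / K ^ 10) * (8 / 5) :=
      mul_le_mul_of_nonneg_left ht85 (by positivity)
    have h2 : ε ^ 2 * exp (-M) ≤ 1 * (1 / (3 * K ^ 10)) :=
      mul_le_mul (by nlinarith) hsK (exp_pos _).le zero_le_one
    have h3 : 1 * (1 / (3 * K ^ 10)) = 1 / K ^ 10 / 3 := by ring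
    have h4 : 0 < 1 / K ^ 10 := by
      have h20 : (0 : ℝ) ≤ 2 * 20 ^ 42 * (Nat.factorial 42 : ℝ) := by positivity
      have : 0 < K := by linarith
      positivity
    have hw4 : 4 / K ^ 10 = 4 * (1 / K ^ 10) := by ring
    have hw2 : (2 * δ + 2 / K ^ 10) * (8 / 5) = 16 / 5 * δ + 16 / 5 * (1 / K ^ 10) := by ring
    linarith
  have hd : |Y t 3| ≤ 4 / K ^ 10 := hde.1.trans hsmall
  have he : |Y t 4| ≤ 4 / K ^ 10 := hde.2.trans hsmall
  -- the carrier: `a² = energy - b² - c² - d² - ã² ≥ 1 - 2ε²e^{-M} - 4ε² - ℓ² - 32/K²⁰`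
  have ha : 999 / 1000 ≤ Y t 0 ^ 2 := by
    have hE := abs_energy_sub_one_le hY hV hR hT h0 hδ₀1 (t := t) ⟨ht.1, ht.2.trans hτ85⟩
    rw [energy_five] at hE
    have hE1 := (abs_le.1 hE).1
    have hb2 : Y t 1 ^ 2 ≤ (2 * ε) ^ 2 := by
      rw [← sq_abs]; exact pow_le_pow_left₀ (abs_nonneg _) hb 2
    have hc2 : Y t 2 ^ 2 ≤ (ε ^ 2) ^ 2 := by
      rw [← sq_abs]; exact pow_le_pow_left₀ (abs_nonneg _) (hcε t ht) 2
    have hd2 : Y t 3 ^ 2 ≤ (4 / K ^ 10) ^ 2 := by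
      rw [← sq_abs]; exact pow_le_pow_left₀ (abs_nonneg _) hd 2
    have he2 : Y t 4 ^ 2 ≤ (4 / K ^ 10) ^ 2 := by
      rw [← sq_abs]; exact pow_le_pow_left₀ (abs_nonneg _) he 2
    have hw4 : 4 / K ^ 10 = 4 * (1 / K ^ 10) := by ring
    have hK4 : 4 / K ^ 10 ≤ 4 / 1000000000000 := by rw [hw4]; linarith
    have hK40 : 0 ≤ 4 / K ^ 10 := by
      have h20 : (0 : ℝ) ≤ 2 * 20 ^ 42 * (Nat.factorial 42 : ℝ) := by positivity
      have : 0 < K := by linarith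
      positivity
    have hK2 : (4 / K ^ 10) ^ 2 ≤ 4 / K ^ 10 * (4 / 1000000000000) := by
      rw [sq]; exact mul_le_mul_of_nonneg_left hK4 hK40
    have hK3 : 4 / K ^ 10 * (4 / 1000000000000) ≤ 4 / 1000000000000 * (4 / 1000000000000) :=
      mul_le_mul_of_nonneg_right hK4 (by norm_num)
    have hε4 : (ε ^ 2) ^ 2 ≤ ε ^ 2 * (1 / 100000) := by
      rw [sq]; exact mul_le_mul_of_nonneg_left hε2 (sq_nonneg ε)
    have hε5 : ε ^ 2 * (1 / 100000) ≤ 1 / 100000 * (1 / 100000) :=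
      mul_le_mul_of_nonneg_right hε2 (by norm_num)
    have hb3 : (2 * ε) ^ 2 = 4 * ε ^ 2 := by ring
    linarith
  exact ⟨hb, ha, hd, he⟩

end Weighted

end Approx

end IgnitionSharp

/-! ## §3. Theorem 5.3 along approximate trajectories and pseudo-orbits, weighted budget pair -/

section Approx

/-- **The gate fires along every differentiable approximate trajectory under the WEIGHTED budget
pair.** For every member `delayCircuitWith K M ε` under the standing hypotheses and every
differentiable approximate trajectory `Y` (velocity `V`, sup-defect `≤ δ` and sup-norm `≤ 2` on
`[0,T)`, `T ≥ 2`) issued `δ₀`-close to (5.6) with `δ₀ + 2δ ≤ ε²e^{-M}/8` and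
`δ₀ + 1.27·δ/√M ≤ 1.2532·ε²e^{-M}/√M`: the trajectory is in the fired state `|ã - 1| ≤ 4K⁻²⁰`,
`|a|, |b|, |c|, |d| ≤ 2K⁻¹⁰` at every `t ∈ [7/4, 2]` (weighted entry state
`exists_triggerLevel_hit_W`, then `Ignition.fired_after'`). Compare
`approxTrajectory_firedOn_late_sharp` (`δ₀ + δT ≤ 1.2532·u`). [cite: Tao2016AveragedNS, §5.5 Theorem 5.3] -/
theorem approxTrajectory_firedOn_late_W (K M ε δ δ₀ T : ℝ) (Y V : ℝ → Fin 5 → ℝ)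
    (hK : 2 * 20 ^ 42 * (Nat.factorial 42 : ℝ) + 16 ≤ K) (hML : 3000 * Real.log K ≤ M)
    (hMK : M ≤ K ^ 10) (hε : 0 < ε) (hεle : ε ≤ exp (-(10 * M)) / K ^ 100) (hT : 2 ≤ T)
    (hY : ∀ t, HasDerivAt Y (V t) t)
    (hV : ∀ t ∈ Ico 0 T, ‖V t - delayCircuitWith K M ε (Y t)‖ ≤ δ)
    (hR : ∀ t ∈ Ico 0 T, ‖Y t‖ ≤ 2) (h0 : ‖Y 0 - delayInit‖ ≤ δ₀)
    (hη : δ₀ + 2 * δ ≤ ε ^ 2 * exp (-M) / 8)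
    (hW : δ₀ + 127 / 100 * δ / Real.sqrt M ≤ 3133 / 2500 * (ε ^ 2 * exp (-M)) / Real.sqrt M) :
    FiredOn K Y (Icc (7 / 4) 2) 4 2 := by
  obtain ⟨τ, hτ, hcτ, -, -, hblate, -⟩ :=
    IgnitionSharp.exists_triggerLevel_hit_W hY hV hR hT hK hML hMK hε hεle h0 hη hW
  have hbτ : 49 / 50 * ε ≤ Y τ 1 := hblate τ ⟨hτ.1.le, le_rfl⟩
  obtain ⟨-, hon, hd0, hd20⟩ := Ignition.transition_params hK hML hMK hε hεle
  obtain ⟨-, -, -, -, hs20, hKinv, -, -⟩ :=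
    Ignition.firing_params' hV hT hK hML hMK hε hεle h0 hη
  have hK16 := (negKick_params hK hML hMK hε hεle).1
  have hsq0 := (Thm53.invSqrt_facts hK16).1
  have hfit2 : τ + 130 * Real.log K / M + K⁻¹ + (Real.sqrt K)⁻¹ < 7 / 4 := by linarith [hτ.2]
  -- the open part `[7/4, 2)`: the firing lemma on the late window `[0, t]`
  have hIco : ∀ t ∈ Ico (7 / 4 : ℝ) 2,
      |Y t 4 - 1| ≤ 4 / K ^ 20 ∧ ∀ i : Fin 5, i ≠ 4 → |Y t i| ≤ 2 / K ^ 10 := by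
    intro t ht
    exact Ignition.fired_after' hY hV hR hT (T' := t) (by linarith [ht.2]) ht.2.le hK hML hMK hε
      hεle h0 hη hτ.1 hcτ hbτ hd0 hon (by linarith [ht.1, hsq0]) ⟨by linarith [ht.1], le_rfl⟩
  intro t ht
  rcases lt_or_eq_of_le ht.2 with h2 | h2
  · exact hIco t ⟨ht.1, h2⟩
  · subst h2
    have h74 : (7 / 4 : ℝ) < 2 := by norm_num
    refine ⟨?_, fun i hi => ?_⟩
    · exact Ignition.le_at_two_of_Ico
        (((Ignition.continuous_coord hY 4).sub continuous_const).abs) h74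
        (fun s hs => (hIco s hs).1)
    · exact Ignition.le_at_two_of_Ico ((Ignition.continuous_coord hY i).abs) h74
        (fun s hs => (hIco s hs).2 i hi)
set_option maxHeartbeats 400000 in -- buildfix (bf3-g27): 160k/180k FAIL, 200k PASS at accept time; line-neutral budget line
/-- **The fired state from the cycle time `2` onwards, WEIGHTED budget pair** (plus `δT ≤ ε²/2`
for the trivial continuation): `|ã - 1| ≤ 6K⁻²⁰` and `|a|, |b|, |c|, |d| ≤ 4K⁻¹⁰` at every
`t ∈ [2, T]` (almost-monotone output, almost-conserved energy, `δ₀ + δT ≤ ε² ≤ K⁻²⁰/40`).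
Compare `approxTrajectory_firedOn_from_two_sharp`. [cite: Tao2016AveragedNS, §5.5 Theorem 5.3] -/
theorem approxTrajectory_firedOn_from_two_W (K M ε δ δ₀ T : ℝ) (Y V : ℝ → Fin 5 → ℝ)
    (hK : 2 * 20 ^ 42 * (Nat.factorial 42 : ℝ) + 16 ≤ K) (hML : 3000 * Real.log K ≤ M)
    (hMK : M ≤ K ^ 10) (hε : 0 < ε) (hεle : ε ≤ exp (-(10 * M)) / K ^ 100) (hT : 2 ≤ T)
    (hY : ∀ t, HasDerivAt Y (V t) t)
    (hV : ∀ t ∈ Ico 0 T, ‖V t - delayCircuitWith K M ε (Y t)‖ ≤ δ)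
    (hR : ∀ t ∈ Ico 0 T, ‖Y t‖ ≤ 2) (h0 : ‖Y 0 - delayInit‖ ≤ δ₀)
    (hη : δ₀ + 2 * δ ≤ ε ^ 2 * exp (-M) / 8)
    (hW : δ₀ + 127 / 100 * δ / Real.sqrt M ≤ 3133 / 2500 * (ε ^ 2 * exp (-M)) / Real.sqrt M)
    (hδT : δ * T ≤ ε ^ 2 / 2) :
    FiredOn K Y (Icc 2 T) 6 4 := by
  have hδ : 0 ≤ δ := Ignition.defect_nonneg hV hT
  have hδ₀ : 0 ≤ δ₀ := (norm_nonneg _).trans h0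
  obtain ⟨-, -, -, hδ₀1, -, -⟩ := Ignition.budget_facts' hV hT hK hML hMK hε hεle h0 hη
  obtain ⟨hε100, -, -, -, -, -, -, -⟩ := Ignition.firing_params' hV hT hK hML hMK hε hεle h0 hη
  obtain ⟨hM6000, hε1, -, -, hMε, -, -, h77, -⟩ := Ignition.ignition_params hK hML hMK hε hεle
  obtain ⟨hK16, -, -, -, -, -⟩ := negKick_params hK hML hMK hε hεle
  have hK0 : (0 : ℝ) < K := by linarith
  have hK1 : (1 : ℝ) ≤ K := by linarith
  -- the budget is below `ε²`, and `40ε² ≤ 1/K²⁰`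
  have hbud : δ₀ + δ * T ≤ ε ^ 2 := by
    have hexp : exp (-M) ≤ 1 := by rw [exp_le_one_iff]; linarith
    have h1 : ε ^ 2 * exp (-M) ≤ ε ^ 2 * 1 := mul_le_mul_of_nonneg_left hexp (sq_nonneg ε)
    nlinarith [sq_nonneg ε]
  have hK20 : 1 / K ^ 100 ≤ 1 / K ^ 20 :=
    one_div_le_one_div_of_le (by positivity) (pow_le_pow_right₀ hK1 (by norm_num))
  have h40ε : 40 * ε ^ 2 ≤ 1 / K ^ 20 := by
    have h1 : 40 * ε ≤ 1 := by nlinarith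
    have h2 : 40 * ε ^ 2 ≤ ε := by nlinarith
    exact h2.trans (hε100.trans hK20)
  have hε2 : ε ^ 2 ≤ 1 / K ^ 20 := by nlinarith [sq_nonneg ε]
  have hK20s : 1 / K ^ 20 ≤ 1 / 16 :=
    one_div_le_one_div_of_le (by norm_num) (le_trans hK16 (le_self_pow₀ hK1 (by norm_num)))
  have r4 : (4 : ℝ) / K ^ 20 = 4 * (1 / K ^ 20) := by ring
  have r6 : (6 : ℝ) / K ^ 20 = 6 * (1 / K ^ 20) := by ring
  -- the fired state at `t = 2`
  obtain ⟨he2, hi2⟩ := approxTrajectory_firedOn_late_W K M ε δ δ₀ T Y V hK hML hMK hε hεle hT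
    hY hV hR h0 hη hW 2 ⟨by norm_num, le_rfl⟩
  rw [r4] at he2
  -- the bounds on `[2, T)`
  have key : ∀ t ∈ Ico 2 T,
      |Y t 4 - 1| ≤ 6 / K ^ 20 ∧ ∀ i : Fin 5, i ≠ 4 → |Y t i| ≤ 4 / K ^ 10 := by
    intro t ht
    have ht0T : t ∈ Ico 0 T := ⟨by linarith [ht.1], ht.2⟩
    -- almost-monotone output
    have hmono : Y 2 4 - δ * (t - 2) ≤ Y t 4 :=
      Ignition.e_sub_ge_late hY hV ht.2 hK0.le (by norm_num) ht.1 le_rfl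
    have hδt : δ * (t - 2) ≤ ε ^ 2 := by
      have : δ * (t - 2) ≤ δ * T := mul_le_mul_of_nonneg_left (by linarith [ht.2]) hδ
      linarith
    have he_lo : 1 - 4 * (1 / K ^ 20) - ε ^ 2 ≤ Y t 4 := by linarith [(abs_le.1 he2).1]
    -- almost-conserved energy
    have hE := Ignition.abs_energy_sub_le hY hV hR ht0T
    have hE0 := Ignition.abs_energy_init_le h0 hδ₀1
    have h20 : 20 * δ * t ≤ 20 * (δ * T) := by nlinarith [ht.2]
    have hEt : energy (Y t) ≤ 1 + 20 * ε ^ 2 := by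
      linarith [(abs_le.1 hE).2, (abs_le.1 hE0).2]
    have he_sq := Ignition.sq_le_energy (Y t) 4
    have he_hi : Y t 4 - 1 ≤ 20 * ε ^ 2 := by
      by_cases h1 : 1 ≤ Y t 4
      · have hid : (Y t 4 - 1) * (Y t 4 + 1) = Y t 4 ^ 2 - 1 := by ring
        have hprod : (Y t 4 - 1) * (Y t 4 + 1) ≤ 20 * ε ^ 2 := by rw [hid]; linarith
        calc Y t 4 - 1 = (Y t 4 - 1) * 1 := by ring
          _ ≤ (Y t 4 - 1) * (Y t 4 + 1) := mul_le_mul_of_nonneg_left (by linarith) (by linarith)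
          _ ≤ 20 * ε ^ 2 := hprod
      · linarith [sq_nonneg ε]
    refine ⟨?_, fun i hi => ?_⟩
    · rw [r6, abs_le]
      constructor <;> linarith
    · -- the other modes carry at most `energy - ã²`
      have hsum := Ignition.sq_add_sq_le_energy (Y t) hi
      have hμ0 : 0 ≤ 1 - 4 * (1 / K ^ 20) - ε ^ 2 := by linarith
      have hesq : (1 - 4 * (1 / K ^ 20) - ε ^ 2) ^ 2 ≤ Y t 4 ^ 2 := pow_le_pow_left₀ hμ0 he_lo 2
      have hexp2 : 1 - 2 * (4 * (1 / K ^ 20) + ε ^ 2) ≤ (1 - 4 * (1 / K ^ 20) - ε ^ 2) ^ 2 := by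
        nlinarith [sq_nonneg (4 * (1 / K ^ 20) + ε ^ 2)]
      have hsq : Y t i ^ 2 ≤ (4 / K ^ 10) ^ 2 := by
        have r16 : ((4 : ℝ) / K ^ 10) ^ 2 = 16 * (1 / K ^ 20) := by ring
        rw [r16]; linarith
      exact abs_le_of_sq_le_sq hsq (by positivity)
  -- the end point `t = T` by continuity
  intro t ht
  by_cases htT : t < T
  · exact key t ⟨ht.1, htT⟩
  have htT' : t = T := le_antisymm ht.2 (not_lt.1 htT)
  rcases eq_or_lt_of_le hT with h2T | h2T
  · have ht2 : t = 2 := by rw [htT', ← h2T]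
    subst ht2
    refine ⟨?_, fun i hi => (hi2 i hi).trans ?_⟩
    · have hK20pos : (0 : ℝ) ≤ 1 / K ^ 20 := by positivity
      rw [r6]; linarith
    · exact div_le_div_of_nonneg_right (by norm_num) (by positivity)
  · rw [htT']
    refine ⟨?_, fun i hi => ?_⟩
    · exact Ignition.le_at_right_of_Ico (g := fun s => |Y s 4 - 1|)
        (((Ignition.continuous_coord hY 4).sub continuous_const).abs) h2T fun s hs => (key s hs).1
    · exact Ignition.le_at_right_of_Ico (g := fun s => |Y s i|)
        ((Ignition.continuous_coord hY i).abs) h2T fun s hs => (key s hs).2 i hi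

end Approx

section Member

variable {K M ε δ δ₀ T : ℝ} {Y : ℝ → Fin 5 → ℝ}

/-- **Theorem 5.3 along every pseudo-orbit under the WEIGHTED budget pair (open form).** Let `Y` be
a `δ`-pseudo-orbit of a member `delayCircuitWith K M ε` in the sup-ball of radius `2` on `[0,T]`
(`T ≥ 2`), issued `δ₀`-close to (5.6), with `δ₀ + 2δ < ε²e^{-M}/8`,
`δ₀ + 1.27·δ/√M < 1.2532·ε²e^{-M}/√M` and `δT < ε²/2` (strict). Then the gate is FIRED on all of
`[2,T]`: `|ã - 1| ≤ 6K⁻²⁰` and `|a|, |b|, |c|, |d| ≤ 4K⁻¹⁰` (smoothing with slack as in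
`IsPseudoOrbit.firedOn_from_two_sharp`). For `T = 2` the sup-forcing may thus be as large as
`δ < ε²e^{-M}/16 - δ₀/2` once `δ₀ < 1.2532·u - 1.27·δ/√M` — `≍ √M/20` times the sharp total-budget
allowance `δ < 0.6266·u`. [cite: Tao2016AveragedNS, §5.5 Theorem 5.3] -/
theorem IsPseudoOrbit.firedOn_from_two_W (hY : IsPseudoOrbit (delayCircuitWith K M ε) δ 2 T Y)
    (hK : 2 * 20 ^ 42 * (Nat.factorial 42 : ℝ) + 16 ≤ K) (hML : 3000 * Real.log K ≤ M)
    (hMK : M ≤ K ^ 10) (hε : 0 < ε) (hεle : ε ≤ exp (-(10 * M)) / K ^ 100) (hT : 2 ≤ T)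
    (h0 : ‖Y 0 - delayInit‖ ≤ δ₀) (hη : δ₀ + 2 * δ < ε ^ 2 * exp (-M) / 8)
    (hW : δ₀ + 127 / 100 * δ / Real.sqrt M < 3133 / 2500 * (ε ^ 2 * exp (-M)) / Real.sqrt M)
    (hδT : δ * T < ε ^ 2 / 2) :
    FiredOn K Y (Icc 2 T) 6 4 := by
  -- parameter facts
  obtain ⟨-, hε1, hε2, hexpM, -, -, -, h77, -⟩ := Ignition.ignition_params hK hML hMK hε hεle
  have hT0 : 0 < T := by linarith
  have hδ : 0 ≤ δ := by
    obtain ⟨V, -, hV⟩ := hY.defect 0 ⟨le_rfl, hT0⟩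
    exact (norm_nonneg _).trans hV
  have hδ₀ : 0 ≤ δ₀ := (norm_nonneg _).trans h0
  have hs0 : 0 < ε ^ 2 * exp (-M) := by positivity
  have hsq0 : (0 : ℝ) < Real.sqrt M := by linarith
  have hs8 : ε ^ 2 * exp (-M) / 8 ≤ 1 / 100 := by
    have h2 : ε ^ 2 * exp (-M) ≤ 1 / 100000 * (1 / 1000000) :=
      mul_le_mul hε2 hexpM (exp_pos _).le (by norm_num)
    linarith
  have hε21 : ε ^ 2 / 2 ≤ 1 / 100 := by linarith
  -- WLOG `Y` is globally continuous
  obtain ⟨Yc, hYcc, hYcY, hYc⟩ := hY.exists_continuous hT0.le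
  have h0c : ‖Yc 0 - delayInit‖ ≤ δ₀ := by rw [hYcY ⟨le_rfl, hT0.le⟩]; exact h0
  have hR₀ : ∀ t ∈ Icc 0 T, ‖Yc t‖ ≤ 6 / 5 :=
    hYc.norm_le_six_fifths hδ h0c (by linarith) (by linarith)
  have hF : Continuous (delayCircuitWith K M ε) := continuous_delayCircuitWith K M ε
  -- the slack: a third of the three gaps
  obtain ⟨g₁, hg₁⟩ : ∃ g : ℝ, g = (ε ^ 2 * exp (-M) / 8 - (δ₀ + 2 * δ)) / 3 := ⟨_, rfl⟩
  obtain ⟨g₂, hg₂⟩ : ∃ g : ℝ,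
      g = (3133 / 2500 * (ε ^ 2 * exp (-M)) / Real.sqrt M - (δ₀ + 127 / 100 * δ / Real.sqrt M)) / 2 :=
    ⟨_, rfl⟩
  obtain ⟨g₃, hg₃⟩ : ∃ g : ℝ, g = (ε ^ 2 / 2 - δ * T) / T := ⟨_, rfl⟩
  have hg₁0 : 0 < g₁ := by rw [hg₁]; exact div_pos (by linarith) (by norm_num)
  have hg₂0 : 0 < g₂ := by rw [hg₂]; exact div_pos (by linarith) (by norm_num)
  have hg₃0 : 0 < g₃ := by rw [hg₃]; exact div_pos (by linarith) hT0
  obtain ⟨η₀, hη₀⟩ : ∃ η₀ : ℝ, η₀ = min g₁ (min g₂ g₃) := ⟨_, rfl⟩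
  have hη₀pos : 0 < η₀ := by rw [hη₀]; exact lt_min hg₁0 (lt_min hg₂0 hg₃0)
  have hη₀1 : η₀ ≤ g₁ := by rw [hη₀]; exact min_le_left _ _
  have hη₀2 : η₀ ≤ g₂ := by rw [hη₀]; exact (min_le_right _ _).trans (min_le_left _ _)
  have hη₀3 : η₀ ≤ g₃ := by rw [hη₀]; exact (min_le_right _ _).trans (min_le_right _ _)
  intro t ht
  have htT : t ∈ Icc 0 T := ⟨by linarith [ht.1], ht.2⟩
  -- the bounds with an extra `η`, for every `η > 0`
  have key : ∀ η : ℝ, 0 < η →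
      |Yc t 4 - 1| ≤ 6 / K ^ 20 + η ∧ ∀ i : Fin 5, i ≠ 4 → |Yc t i| ≤ 4 / K ^ 10 + η := by
    intro η hη
    obtain ⟨η', hη'⟩ : ∃ η' : ℝ, η' = min η (min η₀ (1 / 2)) := ⟨_, rfl⟩
    have hη'0 : 0 < η' := by rw [hη']; exact lt_min hη (lt_min hη₀pos (by norm_num))
    have hη'η : η' ≤ η := by rw [hη']; exact min_le_left _ _
    have hη'η₀ : η' ≤ η₀ := by rw [hη']; exact (min_le_right _ _).trans (min_le_left _ _)
    have hη'2 : η' ≤ 1 / 2 := by rw [hη']; exact (min_le_right _ _).trans (min_le_right _ _)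
    obtain ⟨Z, W, hZd, hWd, hZn, hZY⟩ := hYc.exists_smooth_approx hF hYcc hT0 hR₀ hη'0
    have hR : ∀ s ∈ Ico 0 T, ‖Z s‖ ≤ 2 := fun s hs =>
      (hZn s ⟨hs.1, hs.2.le⟩).trans (by linarith)
    have h0' : ‖Z 0 - delayInit‖ ≤ δ₀ + η' := by
      calc ‖Z 0 - delayInit‖ = ‖(Z 0 - Yc 0) + (Yc 0 - delayInit)‖ := by rw [sub_add_sub_cancel]
        _ ≤ ‖Z 0 - Yc 0‖ + ‖Yc 0 - delayInit‖ := norm_add_le _ _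
        _ ≤ δ₀ + η' := by linarith [hZY 0 ⟨le_rfl, hT0.le⟩]
    have hη1 : (δ₀ + η') + 2 * (δ + η') ≤ ε ^ 2 * exp (-M) / 8 := by
      have h3 : 3 * g₁ = ε ^ 2 * exp (-M) / 8 - (δ₀ + 2 * δ) := by rw [hg₁]; ring
      linarith
    have hW1 : (δ₀ + η') + 127 / 100 * (δ + η') / Real.sqrt M ≤
        3133 / 2500 * (ε ^ 2 * exp (-M)) / Real.sqrt M := by
      have hsplit : 127 / 100 * (δ + η') / Real.sqrt M =
          127 / 100 * δ / Real.sqrt M + 127 / 100 * η' / Real.sqrt M := by ring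
      have hsmallw : 127 / 100 * η' / Real.sqrt M ≤ η' := by
        rw [div_le_iff₀ hsq0]; nlinarith
      have h2 : 2 * g₂ = 3133 / 2500 * (ε ^ 2 * exp (-M)) / Real.sqrt M -
          (δ₀ + 127 / 100 * δ / Real.sqrt M) := by rw [hg₂]; ring
      rw [hsplit]
      linarith
    have hδT1 : (δ + η') * T ≤ ε ^ 2 / 2 := by
      have hTg : η' * T ≤ g₃ * T := mul_le_mul_of_nonneg_right (hη'η₀.trans hη₀3) hT0.le
      have h3 : g₃ * T = ε ^ 2 / 2 - δ * T := by rw [hg₃]; field_simp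
      nlinarith
    obtain ⟨he, hi⟩ := approxTrajectory_firedOn_from_two_W K M ε (δ + η') (δ₀ + η') T Z W hK
      hML hMK hε hεle hT hZd hWd hR h0' hη1 hW1 hδT1 t ht
    have hcoord : ∀ i, |Z t i - Yc t i| ≤ η' := fun i => by
      have h1 := norm_le_pi_norm (Z t - Yc t) i
      rw [Pi.sub_apply, Real.norm_eq_abs] at h1
      exact h1.trans (hZY t htT)
    refine ⟨?_, fun i hi4 => ?_⟩
    · have h1 := abs_le.1 (hcoord 4)
      have h2 := abs_le.1 he
      rw [abs_le]; constructor <;> linarith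
    · have h1 := abs_le.1 (hcoord i)
      have h2 := abs_le.1 (hi i hi4)
      rw [abs_le]; constructor <;> linarith
  rw [← hYcY htT]
  exact ⟨le_of_forall_pos_le_add fun η hη => (key η hη).1,
    fun i hi => le_of_forall_pos_le_add fun η hη => (key η hη).2 i hi⟩

end Member

/-! ## §4. In the reach interface: the weighted budget region is certified -/

/-- **Fires at the cycle time from `(ρ, εd)`**: every `εd`-pseudo-orbit of the member in the sup-ball
of radius `2` on `[0, 2]` issued `ρ`-close to (5.6) is in the fired set `firedSet K e m` at time `2`
— the one property of the member that the reach constructor below consumes.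
[cite: Tao2016AveragedNS, §5.5 Theorem 5.3] -/
def FiresAtTwo (K M ε e m ρ εd : ℝ) : Prop :=
  ∀ x : ℝ → Fin 5 → ℝ, IsPseudoOrbit (delayCircuitWith K M ε) εd 2 2 x →
    ‖x 0 - delayInit‖ ≤ ρ → x 2 ∈ firedSet K e m

/-- A firing budget `B` (`FiresUnderBudget`, CriticalBudget.lean) gives `FiresAtTwo` for every
`ρ + 2εd ≤ B`. [cite: Tao2016AveragedNS, §5.5 Theorem 5.3] -/
theorem firesAtTwo_of_firesUnderBudget {K M ε e m B ρ εd : ℝ} (hF : FiresUnderBudget K M ε e m B)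
    (hB : ρ + εd * 2 ≤ B) : FiresAtTwo K M ε e m ρ εd :=
  fun x hx h0 => hF εd ρ 2 x le_rfl hx h0 hB 2 ⟨le_rfl, le_rfl⟩

/-- **`FiresAtTwo` is a reach certificate.** If every pseudo-orbit from `(ρ, εd)` is fired at
time `2` (and the harmless size condition `7ρ + 40εd ≤ 5/4` holds), the cell's reach interface is
inhabited: `F = delayCircuitWith K M ε`, `U` = the open sup-ball of radius `2`, defect `εd`, cycle
time `2`, `Ain = closedBall delayInit ρ`, `Aout = firedSet K e m`, tube = the closed sup-ball of
radius `3/2` (energy confinement) — `reachCertificateOfFires` (ReachCertificateSharp.lean) with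
the budget hypothesis replaced by its only use. [cite: Tao2016AveragedNS, §5.5 Theorem 5.3] -/
def reachCertificateOfFiresAt {K M ε e m ρ εd : ℝ} (hF : FiresAtTwo K M ε e m ρ εd)
    (hεd : 0 ≤ εd) (hsm : 7 * ρ + 40 * εd ≤ 5 / 4) :
    ReachCertificate (delayCircuitWith K M ε) (ball (0 : Fin 5 → ℝ) 2) εd 2
      (closedBall delayInit ρ) (firedSet K e m) where
  Tube _ _ := closedBall (0 : Fin 5 → ℝ) (3 / 2)
  Tube_closed _ _ := by
    have h : {z : ℝ × (Fin 5 → ℝ) | z.1 ∈ Icc (0 : ℝ) 2 ∧ z.2 ∈ closedBall (0 : Fin 5 → ℝ) (3 / 2)}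
        = Icc (0 : ℝ) 2 ×ˢ closedBall (0 : Fin 5 → ℝ) (3 / 2) := by
      ext z
      simp
    rw [h]
    exact isClosed_Icc.prod isClosed_closedBall
  Tube_zero p hp := by
    rw [mem_closedBall, dist_eq_norm] at hp
    rw [mem_closedBall_zero_iff]
    exact norm_le_three_halves_of_near hp (by linarith)
  Tube_sub _ _ _ _ := by
    intro q hq
    rw [mem_closedBall_zero_iff] at hq
    rw [mem_ball_zero_iff]
    linarith
  cert p hp σT x h0 hσT hx0 hcont hU hW := by
    have hx : IsPseudoOrbit (delayCircuitWith K M ε) εd 2 σT x :=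
      isPseudoOrbit_of_admissible hcont hU hW
    have hp' : ‖x 0 - delayInit‖ ≤ ρ := by
      rw [hx0]
      rwa [mem_closedBall, dist_eq_norm] at hp
    have hρ1 : ρ ≤ 1 := by linarith
    refine ⟨?_, fun h2 => ?_⟩
    · have hE := energy_le_of_admissible hx h0 hσT hp' hρ1 hεd
      rw [mem_closedBall_zero_iff]
      exact norm_le_three_halves_of_energy_le (by linarith)
    · subst h2
      exact ⟨2, ⟨by norm_num, le_rfl⟩, hF x hx hp'⟩

/-- The tube of the certificate is the closed sup-ball of radius `3/2`. [folklore] -/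
theorem reachCertificateOfFiresAt_tube {K M ε e m ρ εd : ℝ} (hF : FiresAtTwo K M ε e m ρ εd)
    (hεd : 0 ≤ εd) (hsm : 7 * ρ + 40 * εd ≤ 5 / 4) (p : Fin 5 → ℝ) (σ : ℝ) :
    (reachCertificateOfFiresAt hF hεd hsm).Tube p σ = closedBall (0 : Fin 5 → ℝ) (3 / 2) :=
  rfl

section StandingW

variable {K M ε : ℝ} (hK : 2 * 20 ^ 42 * (Nat.factorial 42 : ℝ) + 16 ≤ K)
  (hML : 3000 * Real.log K ≤ M) (hMK : M ≤ K ^ 10) (hε : 0 < ε)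
  (hεle : ε ≤ exp (-(10 * M)) / K ^ 100)
include hK hML hMK hε hεle

/-- **The weighted budget region fires at the cycle time**: `ρ + 2εd < ε²e^{-M}/8` and
`ρ + 1.27·εd/√M < 1.2532·ε²e^{-M}/√M` give `FiresAtTwo K M ε 6 4 ρ εd`
(`IsPseudoOrbit.firedOn_from_two_W` with `T = 2`; `2εd < ε²e^{-M}/8 ≤ ε²/2`).
[cite: Tao2016AveragedNS, §5.5 Theorem 5.3] -/
theorem firesAtTwo_W {ρ εd : ℝ} (hη : ρ + εd * 2 < ε ^ 2 * exp (-M) / 8)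
    (hW : ρ + 127 / 100 * εd / Real.sqrt M < 3133 / 2500 * (ε ^ 2 * exp (-M)) / Real.sqrt M) :
    FiresAtTwo K M ε 6 4 ρ εd := by
  intro x hx h0
  have hρ : 0 ≤ ρ := (norm_nonneg _).trans h0
  obtain ⟨hM6000, -, -, -, -, -, -, -, -⟩ := Ignition.ignition_params hK hML hMK hε hεle
  have hexp : exp (-M) ≤ 1 := by rw [exp_le_one_iff]; linarith
  have h1 : ε ^ 2 * exp (-M) ≤ ε ^ 2 * 1 := mul_le_mul_of_nonneg_left hexp (sq_nonneg ε)
  have hδT : εd * 2 < ε ^ 2 / 2 := by nlinarith [sq_nonneg ε]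
  exact hx.firedOn_from_two_W hK hML hMK hε hεle le_rfl h0 (by linarith) hW hδT 2 ⟨le_rfl, le_rfl⟩

/-- **Tao's gate inhabits the reach interface on the weighted budget region.** For every member
under the standing hypotheses, every input radius `ρ ≥ 0` and defect level `εd ≥ 0` with
`ρ + 2εd < ε²e^{-M}/8` and `ρ + 1.27·εd/√M < 1.2532·ε²e^{-M}/√M`: a reach certificate over the open
sup-ball of radius `2`, cycle time `2`, from `closedBall delayInit ρ` into the fired set of
Theorem 5.3 (`|ã - 1| ≤ 6K⁻²⁰`, `|a|,|b|,|c|,|d| ≤ 4K⁻¹⁰`). Contains the triangle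
`ρ + 2εd < 1.2532·u` of `taoReachSharp` (ReachCertificateSharp.lean) and extends it along the
defect axis by the factor `≍ √M/20`. [cite: Tao2016AveragedNS, §5.5 Theorem 5.3] -/
def taoReachW {ρ εd : ℝ} (hρ : 0 ≤ ρ) (hεd : 0 ≤ εd) (hη : ρ + εd * 2 < ε ^ 2 * exp (-M) / 8)
    (hW : ρ + 127 / 100 * εd / Real.sqrt M < 3133 / 2500 * (ε ^ 2 * exp (-M)) / Real.sqrt M) :
    ReachCertificate (delayCircuitWith K M ε) (ball (0 : Fin 5 → ℝ) 2) εd 2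
      (closedBall delayInit ρ) (firedSet K 6 4) :=
  reachCertificateOfFiresAt (firesAtTwo_W hK hML hMK hε hεle hη hW) hεd
    (by
      obtain ⟨-, -, hε2, hexpM, -, -, -, -, -⟩ := Ignition.ignition_params hK hML hMK hε hεle
      have h2 : ε ^ 2 * exp (-M) ≤ 1 / 100000 * (1 / 1000000) :=
        mul_le_mul hε2 hexpM (exp_pos _).le (by norm_num)
      nlinarith)

/-- The tube of `taoReachW` is the closed sup-ball of radius `3/2`. [folklore] -/
theorem taoReachW_tube {ρ εd : ℝ} (hρ : 0 ≤ ρ) (hεd : 0 ≤ εd)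
    (hη : ρ + εd * 2 < ε ^ 2 * exp (-M) / 8)
    (hW : ρ + 127 / 100 * εd / Real.sqrt M < 3133 / 2500 * (ε ^ 2 * exp (-M)) / Real.sqrt M)
    (p : Fin 5 → ℝ) (σ : ℝ) :
    (taoReachW hK hML hMK hε hεle hρ hεd hη hW).Tube p σ = closedBall (0 : Fin 5 → ℝ) (3 / 2) :=
  rfl

/-- **The sharp triangle is inside the weighted region**: `ρ + 2εd < 1.2532·u` implies both weighted
constraints (`1.27/√M ≤ 2` and `1.2532·u ≤ ε²e^{-M}/8`, `sharp_level_le_eighth`), so `taoReachW`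
subsumes `taoReachSharp`. [cite: Tao2016AveragedNS, §5.5 Theorem 5.3] -/
theorem weighted_of_sharp {ρ εd : ℝ} (hεd : 0 ≤ εd)
    (hB : ρ + εd * 2 < 3133 / 2500 * (ε ^ 2 * exp (-M)) / Real.sqrt M) :
    ρ + εd * 2 < ε ^ 2 * exp (-M) / 8 ∧
      ρ + 127 / 100 * εd / Real.sqrt M < 3133 / 2500 * (ε ^ 2 * exp (-M)) / Real.sqrt M := by
  obtain ⟨-, -, -, -, -, -, -, h77, -⟩ := Ignition.ignition_params hK hML hMK hε hεle
  have hsq0 : (0 : ℝ) < Real.sqrt M := by linarith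
  have h8 := IgnitionSharp.sharp_level_le_eighth hK hML hMK hε hεle
  have hw : 127 / 100 * εd / Real.sqrt M ≤ εd * 2 := by
    rw [div_le_iff₀ hsq0]; nlinarith
  exact ⟨hB.trans_le h8, by linarith⟩

/-- **On the defect axis** (`ρ = 0`): a reach certificate for EVERY defect level
`0 ≤ εd < ε²e^{-M}/16` (the weighted constraint `1.27·εd/√M < 1.2532·u` is then automatic) —
against NO certificate for `εd ≥ ε²e^{-M}` (`isEmpty_taoReach_of_seed_le`): the defect axis of
Tao's gate in the reach interface is decided up to the factor `16`.
[cite: Tao2016AveragedNS, §5.5 Theorem 5.3] -/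
def taoReachW_defectAxis {εd : ℝ} (hεd : 0 ≤ εd) (h16 : εd < ε ^ 2 * exp (-M) / 16) :
    ReachCertificate (delayCircuitWith K M ε) (ball (0 : Fin 5 → ℝ) 2) εd 2
      (closedBall delayInit 0) (firedSet K 6 4) :=
  taoReachW hK hML hMK hε hεle le_rfl hεd (by linarith)
    (by
      obtain ⟨-, -, -, -, -, -, -, h77, -⟩ := Ignition.ignition_params hK hML hMK hε hεle
      have hsq0 : (0 : ℝ) < Real.sqrt M := by linarith
      have hs0 : 0 < ε ^ 2 * exp (-M) := by positivity
      rw [zero_add]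
      exact div_lt_div_of_pos_right (by nlinarith) hsq0)

/-- **The defect axis, both sides**: certified for `0 ≤ εd < ε²e^{-M}/16` (cycle time `2`),
impossible for `εd ≥ ε²e^{-M}` (every cycle time `τc ≥ 0`, ReachCertificateSharp §5b).
[cite: Tao2016AveragedNS, §5.5 Theorem 5.3] -/
theorem defectAxis_phases_W {εd : ℝ} (hεd : 0 ≤ εd) :
    (εd < ε ^ 2 * exp (-M) / 16 →
        Nonempty (ReachCertificate (delayCircuitWith K M ε) (ball (0 : Fin 5 → ℝ) 2) εd 2
          (closedBall delayInit 0) (firedSet K 6 4))) ∧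
      (ε ^ 2 * exp (-M) ≤ εd → ∀ τc : ℝ, 0 ≤ τc →
        IsEmpty (ReachCertificate (delayCircuitWith K M ε) (ball (0 : Fin 5 → ℝ) 2) εd τc
          (closedBall delayInit 0) (firedSet K 6 4))) := by
  obtain ⟨hK16, -, -, -, -, -⟩ := negKick_params hK hML hMK hε hεle
  exact ⟨fun h16 => ⟨taoReachW_defectAxis hK hML hMK hε hεle hεd h16⟩,
    fun hs τc hτ => isEmpty_taoReach_of_seed_le (by linarith) le_rfl hs hτ⟩

/-- **The `(ρ, εd)` budget plane, weighted update of `taoReach_phases`** (`u = ε²e^{-M}/√M`,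
`s = ε²e^{-M}`): CERTIFIED on the region `{ρ + 2εd < s/8} ∩ {ρ + 1.27εd/√M < 1.2532u}` (which
contains the sharp triangle `ρ + 2εd < 1.2532u`); IMPOSSIBLE for `ρ ≥ 1.2535u` (cycle time `2`)
and for `εd ≥ s` (every cycle time). Undecided: `s/16 ≤ εd < s` on the defect axis, and the strip
`1.2532u - 1.27εd/√M ≤ ρ < 1.2535u`. [cite: Tao2016AveragedNS, §5.5 Theorem 5.3] -/
theorem taoReach_phases_W {ρ εd : ℝ} (hρ : 0 ≤ ρ) (hεd : 0 ≤ εd) :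
    (ρ + εd * 2 < ε ^ 2 * exp (-M) / 8 →
      ρ + 127 / 100 * εd / Real.sqrt M < 3133 / 2500 * (ε ^ 2 * exp (-M)) / Real.sqrt M →
        Nonempty (ReachCertificate (delayCircuitWith K M ε) (ball (0 : Fin 5 → ℝ) 2) εd 2
          (closedBall delayInit ρ) (firedSet K 6 4))) ∧
    (2507 / 2000 * (ε ^ 2 * exp (-M)) / Real.sqrt M ≤ ρ →
        IsEmpty (ReachCertificate (delayCircuitWith K M ε) (ball (0 : Fin 5 → ℝ) 2) εd 2
          (closedBall delayInit ρ) (firedSet K 6 4))) ∧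
    (ε ^ 2 * exp (-M) ≤ εd → ∀ τc : ℝ, 0 ≤ τc →
        IsEmpty (ReachCertificate (delayCircuitWith K M ε) (ball (0 : Fin 5 → ℝ) 2) εd τc
          (closedBall delayInit ρ) (firedSet K 6 4))) := by
  obtain ⟨-, h2, h3⟩ := taoReach_phases hK hML hMK hε hεle hρ hεd
  exact ⟨fun hη hW => ⟨taoReachW hK hML hMK hε hεle hρ hεd hη hW⟩, h2, h3⟩

/-- **The certifiable radius is flat in the defect**: for `0 ≤ εd` inside the weighted region's
projection, `min (1.2532u - 1.27εd/√M) (s/8 - 2εd) ≤ reachRadius K M ε εd ≤ 1.2535u` — compare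
`reachRadius_mem_Icc` (lower bound `1.2532u - 2εd`, vacuous from `εd = 0.6266u` on).
[cite: Tao2016AveragedNS, §5.5 Theorem 5.3] -/
theorem reachRadius_mem_Icc_W {εd : ℝ} (hεd : 0 ≤ εd) (h16 : εd * 2 < ε ^ 2 * exp (-M) / 8)
    (hWd : 127 / 100 * εd / Real.sqrt M < 3133 / 2500 * (ε ^ 2 * exp (-M)) / Real.sqrt M) :
    reachRadius K M ε εd ∈
      Icc (min (3133 / 2500 * (ε ^ 2 * exp (-M)) / Real.sqrt M - 127 / 100 * εd / Real.sqrt M)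
            (ε ^ 2 * exp (-M) / 8 - εd * 2))
        (2507 / 2000 * (ε ^ 2 * exp (-M)) / Real.sqrt M) := by
  set S : Set ℝ := {ρ : ℝ | Nonempty (ReachCertificate (delayCircuitWith K M ε)
    (ball (0 : Fin 5 → ℝ) 2) εd 2 (closedBall delayInit ρ) (firedSet K 6 4))} with hS
  have hup : ∀ ρ ∈ S, ρ ≤ 2507 / 2000 * (ε ^ 2 * exp (-M)) / Real.sqrt M := fun ρ hρ => by
    by_contra hlt
    exact (isEmpty_taoReach_of_ge hK hML hMK hε hεle hεd (not_le.1 hlt).le).false hρ.some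
  have hbdd : BddAbove S := ⟨_, hup⟩
  have hlow : ∀ ρ, 0 ≤ ρ → ρ + εd * 2 < ε ^ 2 * exp (-M) / 8 →
      ρ + 127 / 100 * εd / Real.sqrt M < 3133 / 2500 * (ε ^ 2 * exp (-M)) / Real.sqrt M → ρ ∈ S :=
    fun ρ hρ hη hW => ⟨taoReachW hK hML hMK hε hεle hρ hεd hη hW⟩
  have h0S : (0 : ℝ) ∈ S := hlow 0 le_rfl (by linarith) (by linarith)
  have hne : S.Nonempty := ⟨0, h0S⟩
  refine ⟨?_, csSup_le hne hup⟩
  by_contra hlt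
  rw [not_le] at hlt
  change sSup S < _ at hlt
  have h0le : 0 ≤ sSup S := le_csSup hbdd h0S
  obtain ⟨ρ, hρ1, hρ2⟩ := exists_between hlt
  have hρa := hρ2.trans_le (min_le_left _ _)
  have hρb := hρ2.trans_le (min_le_right _ _)
  have hρS : ρ ∈ S := hlow ρ (h0le.trans hρ1.le) (by linarith) (by linarith)
  exact absurd (le_csSup hbdd hρS) (not_le.2 hρ1)

/-- The two constraints compared on the defect axis: the weak a-priori one binds —
`ε²e^{-M}/16 < (1.2532/1.27)·u·√M = 0.9868·ε²e^{-M}` — i.e. the factor `16` left open on the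
defect axis is SeedScaleIgnition's a-priori budget `δ₀ + 2δ ≤ ε²e^{-M}/8`, not the Gaussian window.
[cite: Tao2016AveragedNS, §5.5 Theorem 5.3] -/
theorem defectAxis_binding_constraint {εd : ℝ} (h16 : εd < ε ^ 2 * exp (-M) / 16) :
    127 / 100 * εd / Real.sqrt M < 3133 / 2500 * (ε ^ 2 * exp (-M)) / Real.sqrt M := by
  obtain ⟨-, -, -, -, -, -, -, h77, -⟩ := Ignition.ignition_params hK hML hMK hε hεle
  have hsq0 : (0 : ℝ) < Real.sqrt M := by linarith
  have hs0 : 0 < ε ^ 2 * exp (-M) := by positivity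
  exact div_lt_div_of_pos_right (by nlinarith) hsq0

end StandingW

end

end Literature.Analysis.FluidPDE.Tao2016AveragedNS
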